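import Literature.Geometry.Riemannian.PICSphereFactsHolds
import HarnessLib

/-!
# `hamilton_chen_tang_zhu` from Chen–Zhu's structure theorem and Cerf's theorem (status of the discharge)

The named fact `Literature.Geometry.Riemannian.hamilton_chen_tang_zhu` (`HamiltonPIC.lean`;
R. Hamilton, *Four-manifolds with positive isotropic curvature*, Comm. Anal. Geom. 5 (1997),
Cor. 1.2(a), p. 3: a compact four-manifold with no essential incompressible space form — here
`π₁ = 1` — carrying a metric of positive isotropic curvature is diffeomorphic to `S⁴`; complete
proof B.-L. Chen, X.-P. Zhu, J. Differential Geom. 74 (2006), Thm. 1.1 and Cor. 1.2) is the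
tree's **single leaf** for the Hamilton–Chen–Zhu classification in the simply connected case. It
is reduced in the tree, by theorems only, to

* the structure statement of **Chen–Zhu 2006, Thm. 1.1** (p. 3) — `∃ m, ChenZhuResolvableIn m M g₀`
  for every closed simply connected PIC `(M, g₀)` (`SurgicalRicciFlow.lean`): the manifold is
  resolved by a Ricci flow with finitely many surgeries, with the structure (i)–(iv) of the
  stages, the surgeries and the extinct manifold (the analysis: Hamilton 1997 §§2–5 completed on
  Perelman's techniques; in print Thm. 1.1 is "a direct consequence of" the long-time existence
  theorem Thm. 5.6, p. 43) — taken as an explicit HYPOTHESIS, and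
* the leaf named fact `cerf_pi0DiffDisc_relBoundary_three`
  (`Literature/Topology/FourManifolds/CerfPropositionFour.lean`) — J. Cerf (1968), Ch. I §2,
  statement (2): `π₀(Diff(D³; S²)) = 0`.

The chain, all proved: (2) ⇒ Cerf's Théorème 1 `π₀ Diff⁺ S³ = 0`
(`cerf_pi0Diff_sphere_three_of_relBoundary`, `CerfPropositionFour.lean`); Thm. 1.1 + Théorème 1 ⇒
Cor. 1.2(a) (`hamilton_chen_tang_zhu_of_chenZhu_of_cerf`, `SurgicalRicciFlowBridge.lean`: the
reconstruction of the manifold from the pieces of the surgically modified flow, Hamilton 1997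
§1.1 pp. 3–4, where Cerf's theorem identifies the two cappings of each surgery neck). This file
records the compositions, for `hamilton_chen_tang_zhu` and for the two other vendings of
Hamilton's theorem in the simply connected case (`hamilton_pic_connectedSum_spheres_four`,
`hamilton_pic_classification_four`); the twin `hamilton_pic_sphere_four` is
`hamilton_pic_sphere_four_of_chenZhu_of_cerfRelBoundary` (`PICSphereFactsHolds.lean`).

**Why Thm. 1.1 is a hypothesis here and not a named fact (review of the decomposition,
2026-08-15, D-0026/D-0027).** Thm. 1.1's structure statement was vended as a named fact
`chenZhu_ricciFlowWithSurgery`, a decomposition child of `hamilton_chen_tang_zhu`. The review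
found the child *equivalent to its parent* modulo short-time existence of the Ricci flow and
Cerf's theorem: conversely to the chain above, `hamilton_chen_tang_zhu` and
`ricciFlow_shortTime_existence` give the structure statement with `m = 0` surgeries, clause (iv)
`IsUnionOfPieces` being a property of the manifold alone
(`chenZhuResolvable_iff_hamilton_chen_tang_zhu`, `ChenZhuStructureFromClassification.lean`). A
child carrying no proof burden beyond its parent is a restatement (D-0026), so it was merged
back: one leaf, `hamilton_chen_tang_zhu`, whose discharge is exactly a formal proof of the Ricci
flow with surgery — in the tree, the analytic path `chenZhu_ricciFlowWithSurgery_of_step`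
(`SurgicalSolutionsCount.lean`: Chen–Zhu's Thm. 5.6 from the base of the induction and the
surgery step, then Thm. 1.1) composed with `hamilton_chen_tang_zhu_of_chenZhu_of_cerfRelBoundary`
below and `cerf_pi0DiffDisc_relBoundary_three`.

**On Chen–Zhu's Thm. 5.6.** The long-time existence theorem (a solution of the Ricci flow with
surgery satisfying the a priori assumptions, extinct in finite time) is not a named fact either
(an earlier review, same discipline: it is the whole analytic theory of the paper and Thm. 1.1 is
its eight-line corollary); its printed statement is the explicit hypothesis of the proved
reduction `chenZhu_ricciFlowWithSurgery_of_surgicalSolution_existence` (`SurgicalSolutions.lean`,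
Thm. 5.6 ⇒ Thm. 1.1) and the conclusion of the proved count
`chenZhu_surgicalSolution_existence_of_step` (`SurgicalSolutionsCount.lean`, p. 43 "Summing up").

## References

* R. S. Hamilton, *Four-manifolds with positive isotropic curvature*, Comm. Anal. Geom. 5 (1997)
  1–92: Thm. 1.1 (p. 2), Cor. 1.2(a) (p. 3), §1.1 pp. 3–4. [Hamilton1997]
* B.-L. Chen, X.-P. Zhu, *Ricci flow with surgery on four-manifolds with positive isotropic
  curvature*, J. Differential Geom. 74 (2006) 177–264 (arXiv:math/0504478): Thm. 1.1 (p. 3),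
  Thm. 5.6 (p. 43). [ChenZhu2006]
* J. Cerf, *Sur les difféomorphismes de la sphère de dimension trois (Γ₄ = 0)*, Lecture Notes in
  Mathematics 53, Springer (1968), Ch. I §§1–2. [CerfDiffeoSphere1968]
-/

open scoped Manifold ContDiff

namespace Literature.Geometry.Riemannian

open Literature.Topology.FourManifolds

/-- **Hamilton's Cor. 1.2(a) (`hamilton_chen_tang_zhu`) from the structure theorem and Cerf's
theorem**: the structure statement of Chen–Zhu's Thm. 1.1 (`ChenZhuResolvableIn`) and Cerf's
`π₀(Diff(D³; S²)) = 0` (`cerf_pi0DiffDisc_relBoundary_three`) imply `hamilton_chen_tang_zhu`, by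
composing the proved reductions `cerf_pi0Diff_sphere_three_of_relBoundary` ((2) ⇒ Théorème 1) and
`hamilton_chen_tang_zhu_of_chenZhu_of_cerf` (Thm. 1.1 + Théorème 1 ⇒ Cor. 1.2(a)).
[cite: Hamilton1997, Cor. 1.2(a) (p. 3)] [cite: ChenZhu2006, Thm. 1.1 (p. 3)]
[cite: CerfDiffeoSphere1968, Ch. I §2, (2)] -/
theorem hamilton_chen_tang_zhu_of_chenZhu_of_cerfRelBoundary
    (hCZ : ∀ (M : Type) [TopologicalSpace M] [T2Space M] [SecondCountableTopology M]
        [CompactSpace M] [ChartedSpace (EuclideanSpace ℝ (Fin 4)) M] [IsManifold (𝓡 4) ∞ M]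
        [SimplyConnectedSpace M]
        (g₀ : Literature.Geometry.Lorentzian.PseudoRiemannianMetric (𝓡 4) ∞
          (EuclideanSpace ℝ (Fin 4)) (TangentSpace (𝓡 4) : M → Type _)),
        g₀.IsRiemannian → g₀.HasPositiveIsotropicCurvature → ∃ m : ℕ, ChenZhuResolvableIn m M g₀)
    (hcerf : cerf_pi0DiffDisc_relBoundary_three) : hamilton_chen_tang_zhu :=
  hamilton_chen_tang_zhu_of_chenZhu_of_cerf hCZ (cerf_pi0Diff_sphere_three_of_relBoundary hcerf)

/-- Hamilton's Thm. 1.1 in the simply connected case, connected-sum form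
(`hamilton_pic_connectedSum_spheres_four`), from the structure theorem and Cerf's theorem.
[cite: Hamilton1997, Thm. 1.1 (p. 2)] [cite: ChenZhu2006, Thm. 1.1 (p. 3)] -/
theorem hamilton_pic_connectedSum_spheres_four_of_chenZhu_of_cerfRelBoundary
    (hCZ : ∀ (M : Type) [TopologicalSpace M] [T2Space M] [SecondCountableTopology M]
        [CompactSpace M] [ChartedSpace (EuclideanSpace ℝ (Fin 4)) M] [IsManifold (𝓡 4) ∞ M]
        [SimplyConnectedSpace M]
        (g₀ : Literature.Geometry.Lorentzian.PseudoRiemannianMetric (𝓡 4) ∞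
          (EuclideanSpace ℝ (Fin 4)) (TangentSpace (𝓡 4) : M → Type _)),
        g₀.IsRiemannian → g₀.HasPositiveIsotropicCurvature → ∃ m : ℕ, ChenZhuResolvableIn m M g₀)
    (hcerf : cerf_pi0DiffDisc_relBoundary_three) : hamilton_pic_connectedSum_spheres_four :=
  hamilton_pic_connectedSum_spheres_four_of_chenZhu_of_cerf hCZ
    (cerf_pi0Diff_sphere_three_of_relBoundary hcerf)

/-- Hamilton's Thm. 1.1 in the simply connected case with the printed list of pieces
(`hamilton_pic_classification_four`), from the structure theorem and Cerf's theorem.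
[cite: Hamilton1997, Thm. 1.1 (p. 2)] [cite: ChenZhu2006, Thm. 1.1 (p. 3)] -/
theorem hamilton_pic_classification_four_of_chenZhu_of_cerfRelBoundary
    (hCZ : ∀ (M : Type) [TopologicalSpace M] [T2Space M] [SecondCountableTopology M]
        [CompactSpace M] [ChartedSpace (EuclideanSpace ℝ (Fin 4)) M] [IsManifold (𝓡 4) ∞ M]
        [SimplyConnectedSpace M]
        (g₀ : Literature.Geometry.Lorentzian.PseudoRiemannianMetric (𝓡 4) ∞
          (EuclideanSpace ℝ (Fin 4)) (TangentSpace (𝓡 4) : M → Type _)),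
        g₀.IsRiemannian → g₀.HasPositiveIsotropicCurvature → ∃ m : ℕ, ChenZhuResolvableIn m M g₀)
    (hcerf : cerf_pi0DiffDisc_relBoundary_three) : hamilton_pic_classification_four :=
  hamilton_pic_classification_four_of_chenZhu_of_cerf hCZ
    (cerf_pi0Diff_sphere_three_of_relBoundary hcerf)

/-- **The remaining debt of `hamilton_chen_tang_zhu`, as a conjunction**: the fact is implied by
the structure statement of Chen–Zhu's Thm. 1.1 together with Cerf's theorem (and conversely gives
back the structure statement modulo short-time existence, `ChenZhuStructureFromClassification.lean`).
[cite: Hamilton1997, Cor. 1.2(a) (p. 3)] -/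
theorem hamilton_chen_tang_zhu_of_leaves
    (h : (∀ (M : Type) [TopologicalSpace M] [T2Space M] [SecondCountableTopology M]
         [CompactSpace M] [ChartedSpace (EuclideanSpace ℝ (Fin 4)) M] [IsManifold (𝓡 4) ∞ M]
         [SimplyConnectedSpace M]
         (g₀ : Literature.Geometry.Lorentzian.PseudoRiemannianMetric (𝓡 4) ∞
           (EuclideanSpace ℝ (Fin 4)) (TangentSpace (𝓡 4) : M → Type _)),
         g₀.IsRiemannian → g₀.HasPositiveIsotropicCurvature → ∃ m : ℕ, ChenZhuResolvableIn m M g₀) ∧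
      cerf_pi0DiffDisc_relBoundary_three) :
    hamilton_chen_tang_zhu :=
  hamilton_chen_tang_zhu_of_chenZhu_of_cerfRelBoundary h.1 h.2

end Literature.Geometry.Riemannian
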